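import Mathlib
import HarnessLib
import Literature.Computability.AlgebraicComplexity.FlatteningRank
import Summits.MatrixMultiplication.MatrixMultiplication.Theorems.OutsiderSandwichTouchingPoints
import Summits.MatrixMultiplication.MatrixMultiplication.Theorems.OutsiderSandwichContactFace

/-!
# OutsiderSandwich — laser descent to the coupled blocks of `cw₂ ⊗ cw₂` (decomp-mm lens-4, g16)

Kernel of node g16 of the lineage `decomp-mm-lens-4` on `route-MatrixMultiplication-OutsiderSandwich`.

**The move (minimal counterexample, pushed one tensor down).**  The cut of record is
`S ⟺ LaserTangency ∧ LaserMergeOptimal`: a counterexample to `S` is a universal spectral point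
`F` with `τ_F := log₂ F⟨2,2,2⟩ > 2` that TOUCHES the laser floor, `x_F := log₂ F(cw₂) = Λ(τ_F) :=
log₂ 3 + (τ_F − 2)/3`.  Run the laser method on the SQUARE `cw₂ ⊗ cw₂` with the merged blocking
`{x₀₀}, {x₀ᵢ, xᵢ₀}, {xᵢⱼ}` (Coppersmith–Winograd 1990, §7, for `q = 2`): the merged support
`{(0,2,2),(2,0,2),(2,2,0),(1,1,2),(1,2,1),(2,1,1)}` is tight and its block distribution is determined
by its marginals; the three pure blocks are `⟨1,1,4⟩`-shaped matrix products, the three COUPLED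
blocks `C₁ = T^{[211]}, C₂ = T^{[121]}, C₃ = T^{[112]}` (`coupling₁₂₃` below: explicit `4×4×4`
tensors with eight ones, free support, uniform marginals) are not.  At the corner distribution
`(1/9, 4/9, 4/9)` (pure `1/9` each, coupled `2/9` each) the entropy is `2 log₂ 3 − 16/9` EXACTLY and
the resulting packing (`SquaredLaserPacking`, typed here, proved elsewhere) gives the
**squared laser floor** `3¹⁸ · F⟨2,2,2⟩² · F(C)² ≤ 2¹⁶ · F(cw₂)¹⁸` (`SquaredLaserFloor`,
`squaredLaserFloor_of_packing`), `C := C₁ ⊠ C₂ ⊠ C₃` (`couplingTensor`, `64×64×64`).  It reproduces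
`Λ` exactly iff `F(C) = 4 · F⟨2,2,2⟩²` — which is the value of `C` at `ζ₁` and at every quantum
functional — and a touching point is forced to satisfy `F(C) ≤ 4 · F⟨2,2,2⟩²`
(`coupling_le_of_touching`).  Hence the cut descends from `cw₂` to the explicit tensor `C`:

* `CouplingTangency`      `:= ∀ F universal, τ_F > 2 → 4·F⟨2,2,2⟩² < F(C)`  (attacked piece; WEAKER:
  implied by `S` vacuously, `couplingTangency_of_summit`; implies `LaserTangency` given the packing,
  `laserTangency_of_couplingTangency`; implied by the ω-free `CouplingIsMM := ∀ F, F⟨2,2,2⟩³ ≤ F(C)`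
  — "`C` is asymptotically at least `⟨8,8,8⟩`" — with NO packing needed,
  `couplingTangency_of_couplingIsMM`);
* `CouplingMergeOptimal`  `:= ∃ F universal, τ_F = ω ∧ F(C) ≤ 4·F⟨2,2,2⟩²`  (residual; WEAKER:
  implied by `S` via `ζ₁`, `couplingMergeOptimal_of_summit`, using only `ζ₁(C_k) ≤ 4 = #x-indices`;
  implied by `LaserMergeOptimal` given the packing, `couplingMergeOptimal_of_laserMergeOptimal`);
* glue `summit_of_coupling : CouplingTangency → CouplingMergeOptimal → S` (three lines, uses both)
  and the exact cut `summit_iff_coupling`.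

Everything here is sorry-free; `SquaredLaserPacking` is a HYPOTHESIS of the comparison theorems
(an operational, ω-free restriction statement: Coppersmith–Winograd's squaring for `q = 2` read
through BCS Prop. 15.30/15.32 with general — not matrix — components), never assumed elsewhere.

References: [CoppersmithWinograd1990, §6–§7]; [BurgisserClausenShokrollahi1997, Prop. 15.30,
(15.32), Thm. 15.41]; [Strassen1988, Thm. 2.3, 3.8 (`ζ₁`)]; [ChristandlVranaZuiddam2023, §1,
Ex. 1.4 (gauge points), §4 (quantum functionals)]; [Blaser2013, Def. 7.2, §9.3].
-/

noncomputable section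

open scoped BigOperators Topology
open Filter
open Literature.Computability.AlgebraicComplexity
open Summit.MatrixMultiplication.MatrixMultiplication.Theses.OutsiderSandwich
open Summit.MatrixMultiplication.MatrixMultiplication.Theorems.OutsiderSandwichLaserFloor
open Summit.MatrixMultiplication.MatrixMultiplication.Theorems.OutsiderSandwichLaserFloorCut
open Summit.MatrixMultiplication.MatrixMultiplication.Theorems.OutsiderSandwichLaserFloorTop
open Summit.MatrixMultiplication.MatrixMultiplication.Theorems.OutsiderSandwichTouchingPoints
open Summit.MatrixMultiplication.MatrixMultiplication.Theorems.OutsiderSandwichContactFace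

namespace Summit.MatrixMultiplication.MatrixMultiplication.Theorems.OutsiderSandwichCoupling

/-! ## 1. The coupled blocks of `cw₂ ⊗ cw₂` -/

/-- Merged index `1` of `cw₂ ⊗ cw₂`: the pairs with exactly one nonzero coordinate,
`(0,1), (0,2), (1,0), (2,0)` (Coppersmith–Winograd 1990, §7). -/
def mergedOne : Fin 4 → Fin 2 → Fin 3 := ![![0, 1], ![0, 2], ![1, 0], ![2, 0]]

/-- Merged index `2` of `cw₂ ⊗ cw₂`: both coordinates nonzero, `(1,1), (1,2), (2,1), (2,2)`
(Coppersmith–Winograd 1990, §7). -/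
def mergedTwo : Fin 4 → Fin 2 → Fin 3 := ![![1, 1], ![1, 2], ![2, 1], ![2, 2]]

/-- The square `cw₂ ⊗ cw₂` as a tensor power. -/
abbrev cwSq : (Fin 2 → Fin 3) → (Fin 2 → Fin 3) → (Fin 2 → Fin 3) → ℂ :=
  kroneckerPow (cwTensor ℂ 2) 2

/-- The coupled block `C₁ = T^{[211]} = T^{110} ⊗ T^{101} + T^{101} ⊗ T^{110}` of `cw₂ ⊗ cw₂`
(x-indices both nonzero, y- and z-indices with exactly one nonzero coordinate;
Coppersmith–Winograd 1990, §7). -/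
def coupling₁ : Fin 4 → Fin 4 → Fin 4 → ℂ := fun a b c => cwSq (mergedTwo a) (mergedOne b) (mergedOne c)

/-- The coupled block `C₂ = T^{[121]}`. -/
def coupling₂ : Fin 4 → Fin 4 → Fin 4 → ℂ := fun a b c => cwSq (mergedOne a) (mergedTwo b) (mergedOne c)

/-- The coupled block `C₃ = T^{[112]}`. -/
def coupling₃ : Fin 4 → Fin 4 → Fin 4 → ℂ := fun a b c => cwSq (mergedOne a) (mergedOne b) (mergedTwo c)

/-- The coupling tensor `C := C₁ ⊠ C₂ ⊠ C₃` (`64 × 64 × 64`, `512` ones). -/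
def couplingTensor : (Fin 4 × Fin 4) × Fin 4 → (Fin 4 × Fin 4) × Fin 4 → (Fin 4 × Fin 4) × Fin 4 → ℂ :=
  kroneckerTensor (kroneckerTensor coupling₁ coupling₂) coupling₃

/-- `cw₂^{⊠2} ≥ C₁` (zeroing out). [cite: Blaser2013, Def. 7.2] -/
theorem cwSq_restrictsTo_coupling₁ : TensorRestrictsTo cwSq coupling₁ := by
  unfold coupling₁; exact tensorRestrictsTo_precomp _ _ _ _

/-- `cw₂^{⊠2} ≥ C₂` (zeroing out). [cite: Blaser2013, Def. 7.2] -/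
theorem cwSq_restrictsTo_coupling₂ : TensorRestrictsTo cwSq coupling₂ := by
  unfold coupling₂; exact tensorRestrictsTo_precomp _ _ _ _

/-- `cw₂^{⊠2} ≥ C₃` (zeroing out). [cite: Blaser2013, Def. 7.2] -/
theorem cwSq_restrictsTo_coupling₃ : TensorRestrictsTo cwSq coupling₃ := by
  unfold coupling₃; exact tensorRestrictsTo_precomp _ _ _ _

variable {F : SpectralMap ℂ}

/-- `F(cw₂^{⊠2}) = F(cw₂)²`. -/
theorem map_cwSq (hF : IsUniversalSpectralPoint ℂ F) : F cwSq = F (cwTensor ℂ 2) ^ 2 :=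
  hF.map_kroneckerPow _ _

/-- `F(C_k) ≤ F(cw₂)²` for each coupled block. -/
theorem map_coupling_le (hF : IsUniversalSpectralPoint ℂ F) :
    F coupling₁ ≤ F (cwTensor ℂ 2) ^ 2 ∧ F coupling₂ ≤ F (cwTensor ℂ 2) ^ 2 ∧
      F coupling₃ ≤ F (cwTensor ℂ 2) ^ 2 := by
  refine ⟨?_, ?_, ?_⟩ <;> rw [← map_cwSq hF]
  · exact hF.mono _ _ cwSq_restrictsTo_coupling₁
  · exact hF.mono _ _ cwSq_restrictsTo_coupling₂
  · exact hF.mono _ _ cwSq_restrictsTo_coupling₃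

/-- `F(C) = F(C₁) F(C₂) F(C₃)`. -/
theorem map_couplingTensor (hF : IsUniversalSpectralPoint ℂ F) :
    F couplingTensor = F coupling₁ * F coupling₂ * F coupling₃ := by
  unfold couplingTensor
  rw [hF.map_kronecker, hF.map_kronecker]

/-- `ζ₁(t) ≤ #ι` (the flattening rank is at most the number of x-slices). [cite: ChristandlVranaZuiddam2023, Example 1.4] -/
theorem flatteningRank_le_card {ι κ μ : Type} [Fintype ι] (t : ι → κ → μ → ℂ) :
    flatteningRank t ≤ Fintype.card ι := by
  unfold flatteningRank
  exact finrank_range_le_card (R := ℂ) (xSlices t)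

/-- `ζ₁(C_k) ≤ 4` for a `4 × 4 × 4` block. [cite: Strassen1988, Thm. 3.8] -/
theorem gaugePoint₁_le_four (t : Fin 4 → Fin 4 → Fin 4 → ℂ) : gaugePoint₁ ℂ t ≤ 4 := by
  rw [gaugePoint₁_eq]
  have h := flatteningRank_le_card t
  rw [Fintype.card_fin] at h
  exact_mod_cast h

/-- `ζ₁(C) ≤ 64 = 4 · ζ₁⟨2,2,2⟩²` (in fact equality: the flattening ranks of `C_k` are `4`). [cite: Strassen1988, Thm. 3.8] -/
theorem gaugePoint₁_couplingTensor_le :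
    gaugePoint₁ ℂ couplingTensor ≤ 4 * gaugePoint₁ ℂ (matMulTensor ℂ 2 2 2) ^ 2 := by
  have hG := gaugePoint₁_isUniversalSpectralPoint ℂ
  rw [map_couplingTensor hG, gaugePoint₁_matMulTensor_two]
  have h₁ := gaugePoint₁_le_four coupling₁
  have h₂ := gaugePoint₁_le_four coupling₂
  have h₃ := gaugePoint₁_le_four coupling₃
  have h0₁ := hG.nonneg coupling₁
  have h0₂ := hG.nonneg coupling₂
  have h0₃ := hG.nonneg coupling₃
  calc gaugePoint₁ ℂ coupling₁ * gaugePoint₁ ℂ coupling₂ * gaugePoint₁ ℂ coupling₃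
      ≤ 4 * 4 * 4 := mul_le_mul (mul_le_mul h₁ h₂ h0₂ (by norm_num)) h₃ h0₃ (by norm_num)
    _ = 4 * 4 ^ 2 := by norm_num

/-! ## 2. The pieces of the descended cut -/

/-- **CouplingTangency** (attacked piece `A′`): at every universal spectral point above matrix
exponent `2` the coupling tensor beats its `ζ₁`/quantum-functional benchmark `4 · F⟨2,2,2⟩²`.
Equivalently (given `SquaredLaserPacking`): the squared laser method on `cw₂ ⊗ cw₂` is strictly
better than `Λ` at every such point. -/
def CouplingTangency : Prop :=
  ∀ F : SpectralMap ℂ, IsUniversalSpectralPoint ℂ F → 2 < Real.logb 2 (F (matMulTensor ℂ 2 2 2)) →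
    4 * F (matMulTensor ℂ 2 2 2) ^ 2 < F couplingTensor

/-- **CouplingMergeOptimal** (residual `R′`): some ω-attaining universal spectral point does NOT beat
the benchmark on the coupling tensor. -/
def CouplingMergeOptimal : Prop :=
  ∃ F : SpectralMap ℂ, IsUniversalSpectralPoint ℂ F ∧
    Real.logb 2 (F (matMulTensor ℂ 2 2 2)) = omega ℂ ∧ F couplingTensor ≤ 4 * F (matMulTensor ℂ 2 2 2) ^ 2

/-- **CouplingIsMM** (ω-free attack leaf): `F⟨2,2,2⟩³ ≤ F(C)` at every universal spectral point,
i.e. (Strassen's spectral theorem) `C ≳ ⟨8,8,8⟩` asymptotically.  `C` and `⟨8,8,8⟩` have the same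
format `64³`, the same support size `512`, the same value at `ζ₁,ζ₂,ζ₃` and at all quantum
functionals; they are NOT isomorphic (slice-determinant census, node memo), so this is a genuine
asymptotic-equivalence question. -/
def CouplingIsMM : Prop :=
  ∀ F : SpectralMap ℂ, IsUniversalSpectralPoint ℂ F → F (matMulTensor ℂ 2 2 2) ^ 3 ≤ F couplingTensor

/-- **SquaredLaserPacking** (support; Coppersmith–Winograd's squaring for `q = 2`, operational and
ω-free): along a cofinal set of `N`, `(cw₂^{⊠2})^{⊠9N}` restricts to `B` disjoint copies of
`⟨2,2,2⟩^{⊠2N} ⊠ C^{⊠2N}` with `B ≥ 3^{18N} 2^{-(16+ε)N}` — the laser method on `cw₂ ⊗ cw₂` with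
merged blocks at the corner distribution `(1/9,4/9,4/9)`, whose type entropy is `2 log₂ 3 − 16/9`
(Coppersmith–Winograd 1990, §7; Bürgisser–Clausen–Shokrollahi 1997, Prop. 15.30, (15.32)).  A HYPOTHESIS
of the comparison theorems below, to be proved in a separate file; never assumed elsewhere. -/
def SquaredLaserPacking : Prop :=
  ∀ ε : ℝ, 0 < ε → ∀ N₀ : ℕ, ∃ N : ℕ, N₀ ≤ N ∧ ∃ B : ℕ,
    TensorRestrictsTo (kroneckerPow (kroneckerPow (cwTensor ℂ 2) 2) (9 * N))
      (kroneckerTensor (unitTensor ℂ B)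
        (kroneckerTensor (kroneckerPow (matMulTensor ℂ 2 2 2) (2 * N))
          (kroneckerPow couplingTensor (2 * N)))) ∧
    (3 : ℝ) ^ (18 * N) ≤ (B : ℝ) * (2 : ℝ) ^ ((16 + ε) * N)

/-- **SquaredLaserFloor** (spectral form of the packing): `3¹⁸ F⟨2,2,2⟩² F(C)² ≤ 2¹⁶ F(cw₂)¹⁸` for
every universal spectral point — equality at `ζ₁` (`3, 4, 64`) and at all quantum functionals. -/
def SquaredLaserFloor : Prop :=
  ∀ F : SpectralMap ℂ, IsUniversalSpectralPoint ℂ F →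
    3 ^ 18 * F (matMulTensor ℂ 2 2 2) ^ 2 * F couplingTensor ^ 2 ≤ 2 ^ 16 * F (cwTensor ℂ 2) ^ 18

/-! ## 3. Both pieces are implied by the summit (WEAKER, unconditionally) -/

/-- `S ⟹ CouplingTangency` (vacuously: under `ω = 2` no universal point has `τ_F > 2`). -/
theorem couplingTangency_of_summit (hS : _root_.MatrixMultiplication) : CouplingTangency := by
  intro F hF hτ
  have hω : omega ℂ = 2 := (_root_.MatrixMultiplication_iff).1 hS
  have h := matExp_le_omega hF
  linarith

/-- `S ⟹ CouplingMergeOptimal`, witnessed by `ζ₁`: `ζ₁⟨2,2,2⟩ = 4 = 2^ω` and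
`ζ₁(C) ≤ 64 = 4 · ζ₁⟨2,2,2⟩²`. [cite: Strassen1988, Thm. 3.8] -/
theorem couplingMergeOptimal_of_summit (hS : _root_.MatrixMultiplication) : CouplingMergeOptimal := by
  have hω : omega ℂ = 2 := (_root_.MatrixMultiplication_iff).1 hS
  refine ⟨gaugePoint₁ ℂ, gaugePoint₁_isUniversalSpectralPoint ℂ, ?_, gaugePoint₁_couplingTensor_le⟩
  rw [gaugePoint₁_matMulTensor_two, hω, show (4 : ℝ) = (2 : ℝ) ^ (2 : ℝ) by rw [Real.rpow_two]; norm_num,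
    Real.logb_rpow (by norm_num) (by norm_num)]

/-! ## 4. The glue: the descended cut is exact -/

/-- **Glue.** `CouplingTangency → CouplingMergeOptimal → S`: the residual supplies an ω-attaining
point not beating the benchmark, tangency forbids `τ > 2` there, so `ω = τ ≤ 2`. -/
theorem summit_of_coupling (hA : CouplingTangency) (hR : CouplingMergeOptimal) :
    _root_.MatrixMultiplication := by
  obtain ⟨F, hF, hτ, hC⟩ := hR
  have hle : Real.logb 2 (F (matMulTensor ℂ 2 2 2)) ≤ 2 := by
    by_contra h
    push Not at h
    exact absurd hC (not_le.2 (hA F hF h))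
  rw [hτ] at hle
  exact (_root_.MatrixMultiplication_iff).2 (le_antisymm hle (omega_two_le (K := ℂ)))

/-- **The descended cut is exact**: `S ⟺ CouplingTangency ∧ CouplingMergeOptimal`. -/
theorem summit_iff_coupling :
    _root_.MatrixMultiplication ↔ CouplingTangency ∧ CouplingMergeOptimal :=
  ⟨fun h => ⟨couplingTangency_of_summit h, couplingMergeOptimal_of_summit h⟩,
    fun h => summit_of_coupling h.1 h.2⟩

/-! ## 5. The ω-free leaf implies the attacked piece (no packing needed) -/

/-- `τ_F > 2 ⟹ F⟨2,2,2⟩ > 4`. -/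
theorem four_lt_map_matMulTensor (hF : IsUniversalSpectralPoint ℂ F)
    (hτ : 2 < Real.logb 2 (F (matMulTensor ℂ 2 2 2))) : 4 < F (matMulTensor ℂ 2 2 2) := by
  have h0 : 0 < F (matMulTensor ℂ 2 2 2) :=
    lt_of_lt_of_le one_pos (one_le_map_matMulTensor hF (by norm_num))
  have h := (Real.lt_logb_iff_rpow_lt one_lt_two h0).1 hτ
  rw [Real.rpow_two] at h
  linarith

/-- **`CouplingIsMM ⟹ CouplingTangency`**: `4 F² < F · F² = F³ ≤ F(C)` when `F⟨2,2,2⟩ > 4`. -/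
theorem couplingTangency_of_couplingIsMM (h : CouplingIsMM) : CouplingTangency := by
  intro F hF hτ
  have h4 := four_lt_map_matMulTensor hF hτ
  have h0 : 0 < F (matMulTensor ℂ 2 2 2) ^ 2 := by positivity
  calc 4 * F (matMulTensor ℂ 2 2 2) ^ 2 < F (matMulTensor ℂ 2 2 2) * F (matMulTensor ℂ 2 2 2) ^ 2 :=
        mul_lt_mul_of_pos_right h4 h0
    _ = F (matMulTensor ℂ 2 2 2) ^ 3 := by ring
    _ ≤ F couplingTensor := h F hF

/-! ## 6. The squared laser floor from the packing, and what touching forces -/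

/-- **`SquaredLaserPacking ⟹ SquaredLaserFloor`**: apply `F`, take `N`-th roots, let `ε → 0⁺`. -/
theorem squaredLaserFloor_of_packing (hP : SquaredLaserPacking) : SquaredLaserFloor := by
  intro F hF
  have hc0 : 0 ≤ F (cwTensor ℂ 2) := hF.nonneg _
  have hg0 : 0 ≤ F (matMulTensor ℂ 2 2 2) := hF.nonneg _
  have hk0 : 0 ≤ F couplingTensor := hF.nonneg _
  -- for every `ε ∈ (0,1)`: `3¹⁸ g² k² ≤ 2¹⁶ 2^ε c¹⁸`
  have key : ∀ ε : ℝ, 0 < ε → ε < 1 →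
      3 ^ 18 * F (matMulTensor ℂ 2 2 2) ^ 2 * F couplingTensor ^ 2 ≤
        (2 : ℝ) ^ 16 * (2 : ℝ) ^ ε * F (cwTensor ℂ 2) ^ 18 := by
    intro ε hε hε1
    obtain ⟨N, hN, B, hres, hB⟩ := hP ε hε 1
    have hN0 : N ≠ 0 := by omega
    have h := hF.mono _ _ hres
    simp only [hF.map_kronecker, hF.map_unitTensor, hF.map_kroneckerPow] at h
    -- `h : B * (g^(2N) * k^(2N)) ≤ (c^2)^(9N)`
    have e2 : (2 : ℝ) ^ ((16 + ε) * N) = ((2 : ℝ) ^ 16 * (2 : ℝ) ^ ε) ^ N := by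
      rw [Real.rpow_mul_natCast (by norm_num), Real.rpow_add two_pos]
      norm_num
    have e3 : (3 : ℝ) ^ (18 * N) = ((3 : ℝ) ^ 18) ^ N := pow_mul _ _ _
    have egk : F (matMulTensor ℂ 2 2 2) ^ (2 * N) * F couplingTensor ^ (2 * N) =
        (F (matMulTensor ℂ 2 2 2) ^ 2 * F couplingTensor ^ 2) ^ N := by
      rw [mul_pow, pow_mul, pow_mul]
    have ec : (F (cwTensor ℂ 2) ^ 2) ^ (9 * N) = (F (cwTensor ℂ 2) ^ 18) ^ N := by
      rw [← pow_mul, ← pow_mul]; congr 1; ring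
    rw [e2] at hB
    rw [egk, ec] at h
    have hX0 : 0 ≤ (F (matMulTensor ℂ 2 2 2) ^ 2 * F couplingTensor ^ 2) ^ N := by positivity
    have hpow : (3 ^ 18 * F (matMulTensor ℂ 2 2 2) ^ 2 * F couplingTensor ^ 2) ^ N ≤
        ((2 : ℝ) ^ 16 * (2 : ℝ) ^ ε * F (cwTensor ℂ 2) ^ 18) ^ N := by
      calc (3 ^ 18 * F (matMulTensor ℂ 2 2 2) ^ 2 * F couplingTensor ^ 2) ^ N
          = ((3 : ℝ) ^ 18) ^ N * (F (matMulTensor ℂ 2 2 2) ^ 2 * F couplingTensor ^ 2) ^ N := by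
            rw [← mul_pow]; ring
        _ ≤ ((B : ℝ) * ((2 : ℝ) ^ 16 * (2 : ℝ) ^ ε) ^ N) *
              (F (matMulTensor ℂ 2 2 2) ^ 2 * F couplingTensor ^ 2) ^ N := by
            rw [← e3]; exact mul_le_mul_of_nonneg_right hB hX0
        _ = ((2 : ℝ) ^ 16 * (2 : ℝ) ^ ε) ^ N *
              ((B : ℝ) * (F (matMulTensor ℂ 2 2 2) ^ 2 * F couplingTensor ^ 2) ^ N) := by ring
        _ ≤ ((2 : ℝ) ^ 16 * (2 : ℝ) ^ ε) ^ N * (F (cwTensor ℂ 2) ^ 18) ^ N :=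
            mul_le_mul_of_nonneg_left h (by positivity)
        _ = ((2 : ℝ) ^ 16 * (2 : ℝ) ^ ε * F (cwTensor ℂ 2) ^ 18) ^ N := by rw [← mul_pow]
    exact le_of_pow_le_pow_left₀ hN0 (by positivity) hpow
  -- `ε → 0⁺`
  have hlim : Tendsto (fun ε : ℝ => (2 : ℝ) ^ 16 * (2 : ℝ) ^ ε * F (cwTensor ℂ 2) ^ 18) (𝓝[>] 0)
      (𝓝 ((2 : ℝ) ^ 16 * (2 : ℝ) ^ (0 : ℝ) * F (cwTensor ℂ 2) ^ 18)) := by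
    have hc : ContinuousAt (fun x : ℝ => (2 : ℝ) ^ x) 0 := Real.continuousAt_const_rpow (by norm_num)
    have ht : Tendsto (fun x : ℝ => (2 : ℝ) ^ x) (𝓝[>] 0) (𝓝 ((2 : ℝ) ^ (0 : ℝ))) :=
      hc.tendsto.mono_left nhdsWithin_le_nhds
    exact (ht.const_mul _).mul_const _
  rw [Real.rpow_zero, mul_one] at hlim
  refine ge_of_tendsto hlim ?_
  filter_upwards [Ioo_mem_nhdsGT (zero_lt_one' ℝ)] with ε hε using key ε hε.1 hε.2

/-- **Touching forces `F(C) ≤ 4 F⟨2,2,2⟩²`.**  If the squared floor holds at `F` and `F` touches the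
laser floor, `x_F = Λ(τ_F)`, then `F(cw₂)¹⁸ = 3¹⁸ (F⟨2,2,2⟩/4)⁶` and the squared floor collapses to
`F(C)² ≤ 16 F⟨2,2,2⟩⁴`. -/
theorem coupling_le_of_touching (hF : IsUniversalSpectralPoint ℂ F)
    (hq : 3 ^ 18 * F (matMulTensor ℂ 2 2 2) ^ 2 * F couplingTensor ^ 2 ≤ 2 ^ 16 * F (cwTensor ℂ 2) ^ 18)
    (hx : Real.logb 2 (F (cwTensor ℂ 2)) =
      Real.logb 2 3 + (Real.logb 2 (F (matMulTensor ℂ 2 2 2)) - 2) / 3) :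
    F couplingTensor ≤ 4 * F (matMulTensor ℂ 2 2 2) ^ 2 := by
  have hg0 : 0 < F (matMulTensor ℂ 2 2 2) :=
    lt_of_lt_of_le one_pos (one_le_map_matMulTensor hF (by norm_num))
  have hc0 : 0 < F (cwTensor ℂ 2) := by linarith [three_le_map_cwTensor hF]
  have hk0 : 0 ≤ F couplingTensor := hF.nonneg _
  -- `c = 3 · 2^{(τ-2)/3}`
  have hc : F (cwTensor ℂ 2) =
      3 * (2 : ℝ) ^ ((Real.logb 2 (F (matMulTensor ℂ 2 2 2)) - 2) / 3) := by
    have h1 : (2 : ℝ) ^ Real.logb 2 (F (cwTensor ℂ 2)) = F (cwTensor ℂ 2) :=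
      Real.rpow_logb two_pos (by norm_num) hc0
    rw [← h1, hx, Real.rpow_add two_pos, Real.rpow_logb two_pos (by norm_num) (by norm_num)]
  -- `(2^{(τ-2)/3})³ = g/4`
  have hu3 : ((2 : ℝ) ^ ((Real.logb 2 (F (matMulTensor ℂ 2 2 2)) - 2) / 3)) ^ 3 =
      F (matMulTensor ℂ 2 2 2) / 4 := by
    rw [← Real.rpow_natCast, ← Real.rpow_mul (by norm_num : (0 : ℝ) ≤ 2)]
    rw [show (Real.logb 2 (F (matMulTensor ℂ 2 2 2)) - 2) / 3 * ((3 : ℕ) : ℝ) =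
      Real.logb 2 (F (matMulTensor ℂ 2 2 2)) - 2 by push_cast; ring]
    rw [Real.rpow_sub two_pos, Real.rpow_logb two_pos (by norm_num) hg0, Real.rpow_two]
    norm_num
  -- `c¹⁸ = 3¹⁸ (g/4)⁶`
  have h18 : F (cwTensor ℂ 2) ^ 18 = 3 ^ 18 * (F (matMulTensor ℂ 2 2 2) / 4) ^ 6 := by
    rw [hc, mul_pow, ← hu3, ← pow_mul]
  rw [h18] at hq
  -- cancel `3¹⁸ g² > 0`
  have hid : (2 : ℝ) ^ 16 * (3 ^ 18 * (F (matMulTensor ℂ 2 2 2) / 4) ^ 6) =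
      3 ^ 18 * F (matMulTensor ℂ 2 2 2) ^ 2 * (4 * F (matMulTensor ℂ 2 2 2) ^ 2) ^ 2 := by ring
  rw [hid] at hq
  have hpos : 0 < (3 : ℝ) ^ 18 * F (matMulTensor ℂ 2 2 2) ^ 2 := by positivity
  have hsq : F couplingTensor ^ 2 ≤ (4 * F (matMulTensor ℂ 2 2 2) ^ 2) ^ 2 :=
    le_of_mul_le_mul_left hq hpos
  exact (pow_le_pow_iff_left₀ hk0 (by positivity) two_ne_zero).1 hsq

/-! ## 7. Laser descent: the new cut refines the cut of record (given the packing) -/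

/-- **`SquaredLaserFloor ⟹ (CouplingTangency ⟹ LaserTangency)`**: an off-corner violation would be a
touching point with `τ > 2`, where touching forces `F(C) ≤ 4F²` against tangency's `4F² < F(C)`. -/
theorem laserTangency_of_couplingTangency (hQ : SquaredLaserFloor) (hA : CouplingTangency) :
    LaserTangency := by
  rw [laserTangency_iff_offCorner]
  intro F hF hτ
  rcases (laserFloor hF).lt_or_eq with h | h
  · exact h
  · exact absurd (coupling_le_of_touching hF (hQ F hF) h.symm) (not_le.2 (hA F hF hτ))

/-- **`SquaredLaserFloor ⟹ (LaserMergeOptimal ⟹ CouplingMergeOptimal)`**: the residual only gets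
weaker — a touching ω-attaining point does not beat the benchmark. -/
theorem couplingMergeOptimal_of_laserMergeOptimal (hQ : SquaredLaserFloor) (h : LaserMergeOptimal) :
    CouplingMergeOptimal := by
  obtain ⟨F, hF, hτ, hx⟩ := laserMergeOptimal_iff_corner.1 h
  refine ⟨F, hF, hτ, coupling_le_of_touching hF (hQ F hF) ?_⟩
  rw [hx, hτ]

/-- **Laser descent** (the comparison of cuts, packaged): given the squaring packing, the attacked
piece of the new cut implies the attacked crux of record and the residual of record implies the new
residual. -/
theorem laserDescent (hP : SquaredLaserPacking) :
    (CouplingTangency → LaserTangency) ∧ (LaserMergeOptimal → CouplingMergeOptimal) :=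
  ⟨laserTangency_of_couplingTangency (squaredLaserFloor_of_packing hP),
    couplingMergeOptimal_of_laserMergeOptimal (squaredLaserFloor_of_packing hP)⟩

/-- **The attack line on the crux of record**: `SquaredLaserPacking → CouplingIsMM → LaserTangency`
— a formalisation task with a known proof plus ONE ω-free asymptotic statement about the explicit
`64 × 64 × 64` tensor `C`. -/
theorem laserTangency_of_couplingIsMM (hP : SquaredLaserPacking) (h : CouplingIsMM) : LaserTangency :=
  laserTangency_of_couplingTangency (squaredLaserFloor_of_packing hP) (couplingTangency_of_couplingIsMM h)

/-- Under the packing, the summit follows from the ω-free leaf and the residual of record. -/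
theorem summit_of_couplingIsMM (hP : SquaredLaserPacking) (h : CouplingIsMM) (hR : LaserMergeOptimal)
    (hI : SummitIffLaserTangency) : _root_.MatrixMultiplication :=
  hI.2 ⟨laserTangency_of_couplingIsMM hP h, hR⟩


end Summit.MatrixMultiplication.MatrixMultiplication.Theorems.OutsiderSandwichCoupling
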